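import Summits.BirchSwinnertonDyer.Rank1Residual.F1Sign2.UnitPlaneIncrementLawAtTwo
import HarnessLib

/-!
# DESC-44 kernel — -desc g34's three glue theorems (Sketch44 v2 cc7b15935ad3fb05 l.100–128, VERBATIM) and REF1-AUDIT §290/§295's kernel probes for
# `F1Sign2/UnitPlaneIncrementLawAtTwo.lean` (typer -ty g21)

CONTENT (all PROVED, no `sorry`, no `def`): `unitPlaneTwistPairIncrementLaw_of_congruent` (DESC-44-C ⟹ DESC-44-T), `incrementBits_aux`, `unitPlane_twist_bits_of_incrementLaw`
(under C, equal level-0 bits ⟹ equal level-1 bits at every common rigid twist, opposite ⟹ opposite) — -desc, VERBATIM; REF1 §290 (`REF1-data/b290/Probe290.lean`, block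
`REF1_290`): K290.1 `rigid_one`, K290.2 `rigid_eq_one_of_even_traces`, K290.4 `cubicDatum_dvd_of_rational_root` (the junk mechanism: a RATIONAL 2-torsion abscissa makes the
`CubicDatumFor` divisibility hold for EVERY cubic), K290.6 `not_isSquare_229`; REF1 §295 (`REF1-data/b295/Probe295.lean`, block `REF1_295`): K295.1 `flipped_ne_one`, K295.2
`flipped_unsat_of_even_traces`, K295.3 `desc44F_at_junkSeed`, K295.4 `switchedOffSharpAt_odd_iff` — proofs VERBATIM, statements re-homed to this namespace.  NOT re-homed:
K290.3/3′ `desc44V_false_of_junkSeed` / `desc44V_false_of_twoTorsionSeed` (they state `¬ UnitPlaneRigidCasselsTateSignVariesAtTwo`, the HELD row V, absent from the tree)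
and K290.5/5′ `W65_data` / `W65_cubicDatum_dvd` (need the auxiliary `def W65`; kernel files carry no defs).  REF1 gates: §290 (v1) + §295 (v2 cc7b15935ad3fb05).
-/

open scoped Classical

open WeierstrassCurve Literature.NumberTheory.EllipticCurves Literature.NumberTheory.DiophantineGeometry Polynomial IsDedekindDomain NumberField

namespace Summit.BirchSwinnertonDyer.Rank1Residual.F1Sign2

/-- (-desc g34 Sketch44 v2 cc7b15935ad3fb05, VERBATIM.) glue (PROVED): the congruent-pair law contains the twist-pair rung. -/
theorem unitPlaneTwistPairIncrementLaw_of_congruent (h : UnitPlaneCongruentIncrementLawAtTwo) : UnitPlaneTwistPairIncrementLawAtTwo := by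
  intro E₀ E₁ _ _ _ _ c xnum₀ xnum₁ xden₀ xden₁ B2 B4 B6 B2' B4' B6' h₀ h₁ _ n hn₀ hn₁
  exact h E₀ E₁ c xnum₀ xnum₁ xden₀ xden₁ B2 B4 B6 B2' B4' B6' h₀ h₁ n hn₀ hn₁

/-- (-desc g34 Sketch44 v2 cc7b15935ad3fb05, VERBATIM.) propositional bookkeeping for `unitPlane_twist_bits_of_incrementLaw`. -/
theorem incrementBits_aux {A₀ B₀ A₁ B₁ : Prop} (key : (A₀ ↔ B₀) ↔ (A₁ ↔ B₁)) :
    ((B₀ ↔ B₁) → (A₀ ↔ A₁)) ∧ (¬ (B₀ ↔ B₁) → ¬ (A₀ ↔ A₁)) := by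
  constructor
  · intro h; tauto
  · intro h; tauto

/-- (-desc g34 Sketch44 v2 cc7b15935ad3fb05, VERBATIM.) glue (PROVED): under the law, a congruent pair with EQUAL level-0 bits has equal level-1 bits at every common rigid twist, and a pair with OPPOSITE level-0 bits has
opposite level-1 bits (the whole rigid family is shifted by the constant `θ(E₀) ⊕ θ(E₁)`). -/
theorem unitPlane_twist_bits_of_incrementLaw (h : UnitPlaneCongruentIncrementLawAtTwo)
    {E₀ E₁ : WeierstrassCurve ℚ} [E₀.IsElliptic] [E₀.IsGloballyMinimal] [E₁.IsElliptic] [E₁.IsGloballyMinimal]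
    {c xnum₀ xnum₁ : ℤ[X]} {xden₀ xden₁ : ℕ} {B2 B4 B6 B2' B4' B6' : ℤ}
    (h₀ : UnitPlaneSeedAtTwo E₀ c xnum₀ xden₀ B2 B4 B6) (h₁ : UnitPlaneSeedAtTwo E₁ c xnum₁ xden₁ B2' B4' B6')
    {n : ℕ} (hn₀ : RigidThreeCycleTwist E₀ n) (hn₁ : RigidThreeCycleTwist E₁ n) :
    ((ShaTwoInTwiceShaFour E₀ ↔ ShaTwoInTwiceShaFour E₁) →
        (ShaTwoInTwiceShaFour (E₀.quadraticTwist ((n : ℤ) : ℚ)) ↔ ShaTwoInTwiceShaFour (E₁.quadraticTwist ((n : ℤ) : ℚ)))) ∧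
      (¬ (ShaTwoInTwiceShaFour E₀ ↔ ShaTwoInTwiceShaFour E₁) →
        ¬ (ShaTwoInTwiceShaFour (E₀.quadraticTwist ((n : ℤ) : ℚ)) ↔ ShaTwoInTwiceShaFour (E₁.quadraticTwist ((n : ℤ) : ℚ)))) := by
  exact incrementBits_aux (h E₀ E₁ c xnum₀ xnum₁ xden₀ xden₁ B2 B4 B6 B2' B4' B6' h₀ h₁ n hn₀ hn₁)

/-! ### REF1-AUDIT §290 / §295 kernel probes (re-homed by the typer; see the module docstring for the two families left in the evidence files) -/

/-- (REF1 §290 `REF1-data/b290/Probe290.lean`, VERBATIM.) K290.1: `n = 1` is a rigid 3-cycle twist parameter for EVERY curve (all prime conditions vacuous, `J(1|ℓ) = 1`). -/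
theorem rigid_one (W : WeierstrassCurve ℚ) [W.IsGloballyMinimal] : RigidThreeCycleTwist W 1 := by
  refine ⟨⟨Nat.one_pos, squarefree_one, ?_⟩, by decide, ?_, ?_⟩
  · intro q hq hq1
    exact absurd (Nat.le_of_dvd Nat.one_pos hq1) (by have := hq.one_lt; omega)
  · intro ℓ _ _ _
    exact jacobiSym.one_left ℓ
  · intro q hq hq1
    exact absurd (Nat.le_of_dvd Nat.one_pos hq1) (by have := hq.one_lt; omega)

/-- (REF1 §290 `REF1-data/b290/Probe290.lean`, VERBATIM.) K290.2: if every odd good prime has EVEN Frobenius trace (as for any curve with a rational 2-torsion point), then the ONLY rigid parameter is `n = 1`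
(a squarefree `n > 1` has a prime factor `q`, which `TwistSupportGoodOdd` makes odd and good, and rigidity wants `a_q` odd). -/
theorem rigid_eq_one_of_even_traces (W : WeierstrassCurve ℚ) [W.IsGloballyMinimal]
    (hev : ∀ q : ℕ, q.Prime → q ≠ 2 → (∀ _h : Fact q.Prime, W.HasGoodReductionAtPrime q) → Even (W.frobeniusTrace q))
    {n : ℕ} (hn : RigidThreeCycleTwist W n) : n = 1 := by
  obtain ⟨⟨hpos, -, hsupp⟩, -, -, hodd⟩ := hn
  by_contra h1
  have h2 : n ≠ 1 := h1
  have hq : (Nat.minFac n).Prime := Nat.minFac_prime h2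
  have hqn : Nat.minFac n ∣ n := Nat.minFac_dvd n
  obtain ⟨hq2, hgood⟩ := hsupp _ hq hqn
  exact (Int.not_even_iff_odd.mpr (hodd _ hq hqn)) (hev _ hq hq2 hgood)

/-- (REF1 §290 `REF1-data/b290/Probe290.lean`, VERBATIM.) K290.4: the `CubicDatumFor` divisibility conjunct is satisfied by a CONSTANT abscissa polynomial `xnum = C k` whenever `k/xden` is a RATIONAL root of the 2-division
polynomial — for ANY cubic `c` (the cleared numerator is then the zero polynomial).  This is the junk instance: `c` is not tied to `W`. -/
theorem cubicDatum_dvd_of_rational_root (W : WeierstrassCurve ℚ) (c : ℤ[X]) (k : ℤ) (xden : ℕ)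
    (hroot : 4 * (k : ℚ) ^ 3 + W.b₂ * (k : ℚ) ^ 2 * xden + 2 * W.b₄ * k * (xden : ℚ) ^ 2 + W.b₆ * (xden : ℚ) ^ 3 = 0) :
    (C (4 : ℚ) * ((C k : ℤ[X]).map (Int.castRingHom ℚ)) ^ 3 + C W.b₂ * ((C k : ℤ[X]).map (Int.castRingHom ℚ)) ^ 2 * C (xden : ℚ) +
        C (2 * W.b₄) * ((C k : ℤ[X]).map (Int.castRingHom ℚ)) * C ((xden : ℚ) ^ 2) + C (W.b₆ * (xden : ℚ) ^ 3)) %ₘ (c.map (Int.castRingHom ℚ)) = 0 := by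
  have hk : ((C k : ℤ[X]).map (Int.castRingHom ℚ)) = C (k : ℚ) := by simp
  rw [hk]
  have hC : C (4 : ℚ) * C (k : ℚ) ^ 3 + C W.b₂ * C (k : ℚ) ^ 2 * C (xden : ℚ) + C (2 * W.b₄) * C (k : ℚ) * C ((xden : ℚ) ^ 2) + C (W.b₆ * (xden : ℚ) ^ 3)
      = C (4 * (k : ℚ) ^ 3 + W.b₂ * (k : ℚ) ^ 2 * xden + 2 * W.b₄ * k * (xden : ℚ) ^ 2 + W.b₆ * (xden : ℚ) ^ 3) := by
    simp only [C_add, C_mul, C_pow]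
  rw [hC, hroot, map_zero, zero_modByMonic]

/-- (REF1 §290 `REF1-data/b290/Probe290.lean`, VERBATIM.) K290.6: `229 = disc(X³ − 4X − 1)` is not a square (squares mod 7 are 0,1,2,4; 229 ≡ 5), so that `c` is an `S₃` cubic: the junk pairs an S₃ datum with a 2-torsion curve. -/
theorem not_isSquare_229 : ¬ IsSquare (229 : ℤ) := by
  rintro ⟨r, hr⟩
  have h7 : ((229 : ℤ) : ZMod 7) = ((r * r : ℤ) : ZMod 7) := by rw [hr]
  push_cast at h7
  revert h7
  generalize (r : ZMod 7) = x
  decide +revert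

/-- (REF1 §295 `REF1-data/b295/Probe295.lean`, VERBATIM.) K295.1: a flipped 3-cycle twist parameter is never `1` (`(1/p) = 1 ≠ −1`). -/
theorem flipped_ne_one (W : WeierstrassCurve ℚ) [W.IsGloballyMinimal] (p : ℕ) {n : ℕ}
    (hn : FlippedThreeCycleTwist W p n) : n ≠ 1 := by
  rintro rfl
  obtain ⟨-, -, hj, -, -⟩ := hn
  rw [Nat.cast_one, jacobiSym.one_left] at hj
  norm_num at hj

/-- (REF1 §295 `REF1-data/b295/Probe295.lean`, VERBATIM.) K295.2 (junk seeds make DESC-44-F VACUOUS, not false): if every odd good trace of `W` is EVEN (e.g. `W` has a rational 2-torsion point —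
the junk seeds REF1 §290 showed `UnitPlaneSeedAtTwo` does not exclude), then NO `n` is a flipped 3-cycle twist (`n ≠ 1` has a prime factor `q`, whose trace must be odd). -/
theorem flipped_unsat_of_even_traces (W : WeierstrassCurve ℚ) [W.IsGloballyMinimal]
    (hev : ∀ q : ℕ, q.Prime → q ≠ 2 → (∀ _h : Fact q.Prime, W.HasGoodReductionAtPrime q) → Even (W.frobeniusTrace q))
    (p n : ℕ) : ¬ FlippedThreeCycleTwist W p n := by
  intro hn
  have h1 : n ≠ 1 := flipped_ne_one W p hn
  obtain ⟨⟨-, -, hsupp⟩, -, -, -, hodd⟩ := hn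
  have hq : (Nat.minFac n).Prime := Nat.minFac_prime h1
  have hqn : Nat.minFac n ∣ n := Nat.minFac_dvd n
  obtain ⟨hq2, hgood⟩ := hsupp _ hq hqn
  exact (Int.not_even_iff_odd.mpr (hodd _ hq hqn)) (hev _ hq hq2 hgood)

/-- (REF1 §295 `REF1-data/b295/Probe295.lean`, VERBATIM.) K295.3: hence DESC-44-F holds AT every such junk seed (its `∀ n, FlippedThreeCycleTwist W p n → …` is vacuous there) — the missing
`Irreducible (twoDivisionUCubic W)` conjunct (R290a) is load-bearing for DESC-44-V only. -/
theorem desc44F_at_junkSeed (W : WeierstrassCurve ℚ) [W.IsGloballyMinimal]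
    (hev : ∀ q : ℕ, q.Prime → q ≠ 2 → (∀ _h : Fact q.Prime, W.HasGoodReductionAtPrime q) → Even (W.frobeniusTrace q))
    (p : ℕ) (n : ℕ) (P : ℕ → Prop) : FlippedThreeCycleTwist W p n → P n :=
  fun hn => (flipped_unsat_of_even_traces W hev p n hn).elim

/-- (REF1 §295 `REF1-data/b295/Probe295.lean`, VERBATIM.) K295.4 (carrier consequence used in the audit of THM-cand 44.4 (iv)): inside `UnitPlaneSeedAtTwo` every place is sharp-OFF; at an ODD place the sharp-OFF
predicate is literally THM 39.1's `SwitchedOffAt` (the second disjunct needs `ℓ = 2`). -/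
theorem switchedOffSharpAt_odd_iff (W : WeierstrassCurve ℚ) (c F : ℤ[X]) (v : HeightOneSpectrum (𝓞 ℚ)) {ℓ : ℕ} (hℓ : ℓ ≠ 2) :
    SwitchedOffSharpAt W c F v ℓ ↔ SwitchedOffAt W c v ℓ := by
  unfold SwitchedOffSharpAt
  constructor
  · rintro (h | ⟨h2, -⟩)
    · exact h
    · exact (hℓ h2).elim
  · exact Or.inl

end Summit.BirchSwinnertonDyer.Rank1Residual.F1Sign2
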